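import Literature.NumberTheory.Automorphic.LinearIndependenceOfCharacters
import Literature.NumberTheory.Automorphic.SmoothTraceLinearIndependenceUnitary
import Literature.NumberTheory.Automorphic.LocalUnitaryIntegralLevel
import HarnessLib

/-!
# DISCHARGE of Rogawski's Prop. 13.8.1 (`Z = 1`) for the semi-local unitary groups `∏_{v ∈ S} U(H)(L⁺_v)`:
# `unitaryCharactersLinearIndependent_holds`

Topic `NumberTheory/Automorphic`; namespace `Literature.NumberTheory.Automorphic`.  THEOREMS ONLY (no definition, no instance, no notation, no named
fact, no `sorry`).  Cell `hodgecm-mathlib` (D-0151), floor 0, programme P3 rung 4 (F0P3-plan (g4) RULING (V17)), file (U4): the IN-HOUSE PROOF of the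
letter ★ `Literature.NumberTheory.Automorphic.unitaryCharactersLinearIndependent` (`LinearIndependenceOfCharacters.lean`, class **P**,
[Rogawski1990, Prop. 13.8.1 p. 206] = [JacquetLanglands1970, Lemma 16.1.1]) — its `def … : Prop` and its consumer (T5 law `LinIndepS`) stay
token-unchanged; REF1's audit is `example : unitaryCharactersLinearIndependent := unitaryCharactersLinearIndependent_holds`.  The work is ★ (U3)
`IrrClass.eq_zero_of_summable_mul_smoothTrace` (countable families of admissible UNITARIZABLE classes, any group with a compact open subgroup); here
only the compact open subgroup `K₀ := ∏_{v ∈ S} U(H)(𝒪_v)` of `∏_{v ∈ S} U(H)(L⁺_v)` is supplied (★ `isCompact_isOpen_cmLocalIntegralLevel`).  The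
letter's hermitian ∕ unit-determinant hypotheses on `H` are not needed.  Unimodularity is NOT used anywhere on the road.
HC_CM is proved only modulo the printed citations until rung 0 closes; on landing, this file REMOVES the letter (L2) [Rogawski1990, Prop. 13.8.1] from
that list (F0P3-plan (V17): the honest label drops one printed citation).

## References
* [Rogawski1990] J. D. Rogawski, *Automorphic Representations of Unitary Groups in Three Variables*, Ann. of Math. Stud. 123 (1990), Prop. 13.8.1 p. 206.
* [JacquetLanglands1970] H. Jacquet, R. P. Langlands, *Automorphic Forms on GL(2)*, LNM 114 (1970), Lemma 16.1.1.
-/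

set_option autoImplicit false

noncomputable section

open MeasureTheory

namespace Literature.NumberTheory.Automorphic

open NumberField IsDedekindDomain UnitaryGroup in
/-- **DISCHARGE OF THE (L2) LETTER — Rogawski's Prop. 13.8.1 (`Z = 1`) for the semi-local unitary groups `∏_{v ∈ S} U(H)(L⁺_v)` IS A THEOREM**:
★ `unitaryCharactersLinearIndependent` holds (the compact open subgroup is `∏_{v ∈ S} U(H)(𝒪_v)`, ★ `isCompact_isOpen_cmLocalIntegralLevel`; the
rest is ★ (U3) `IrrClass.eq_zero_of_summable_mul_smoothTrace`).  The hermitian ∕ unit-determinant hypotheses of the letter are not needed by the proof. [cite: Rogawski1990, Prop. 13.8.1 p. 206]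
[cite: JacquetLanglands1970, Lemma 16.1.1] -/
theorem unitaryCharactersLinearIndependent_holds : unitaryCharactersLinearIndependent := by
  intro L _ _ _ N H _ _ S _ _ μ _ ι _ c hc hcu a ha
  -- the compact open subgroup `K₀ := ∏_{v ∈ S} U(H)(𝒪_v)`
  let Kv : ∀ v : ↥S, Subgroup ((cmDatum L N H).Local v.1) := fun v => cmLocalIntegralLevel L N H v.1
  let K₀ : Subgroup (∀ v : ↥S, (cmDatum L N H).Local v.1) := Subgroup.pi Set.univ Kv
  have hK₀ : (K₀ : Set (∀ v : ↥S, (cmDatum L N H).Local v.1)) = Set.pi Set.univ fun v => (Kv v : Set ((cmDatum L N H).Local v.1)) := by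
    ext x
    simp [K₀, Subgroup.mem_pi]
  have hK₀o : IsOpen (K₀ : Set (∀ v : ↥S, (cmDatum L N H).Local v.1)) := by
    rw [hK₀]
    exact isOpen_set_pi Set.finite_univ fun v _ => (isCompact_isOpen_cmLocalIntegralLevel L N H v.1).2
  have hK₀c : IsCompact (K₀ : Set (∀ v : ↥S, (cmDatum L N H).Local v.1)) := by
    rw [hK₀]
    exact isCompact_univ_pi fun v => (isCompact_isOpen_cmLocalIntegralLevel L N H v.1).1
  exact IrrClass.eq_zero_of_summable_mul_smoothTrace μ K₀ hK₀o hK₀c c hc hcu a ha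

end Literature.NumberTheory.Automorphic

end
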